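import Mathlib
import Literature.Computability.AlgebraicComplexity.PlethysmLifting

/-!
# Explicit padded-permanent highest-weight vectors: the VISIBILITY LAW of twist-free certification
# points (which seeds the `x_top`-linear and the `x_top`-pure certificates can see at all)

Wall-breaker axis k5 of crux `ValuativeGCT.ValuativeFlip` (stmt-ValiantsHypothesis-12624), stub
`stub_seedRichness`.  The two `m`-free certification schemes for padded highest-weight vectors in the
tree evaluate a seed `F ∈ ℂ[Sym^n ℂ^σ]` (a torus weight vector of weight `χ`, a form of degree `δ`)
at forms `q` that are either LINEAR in the top variable (`psl_seedLift_transfer`,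
`…SeedLift(Per).lean`) or PURE of some degree `r` in it (`mk_liftHWV_ne_zero_of_topPure`,
`…SeedTwoRow.lean`), because exactly there BIP's twist `Δ_j` is a scalar (times a torus element).
This file proves the law governing what such points can see — a no-go lemma steering the residual
"explicit rich seeds" (AXIS note of this seat, §3):

* `aeval_formCoeff_eq_zero_of_apply_le_one` — if `-χ(i) > δ` (for weights of coordinate rings:
  the first row `μ₁` of `μ`, `χ = μ*`, exceeds the degree), then `F(q) = 0` for EVERY form `q` of
  degree `≤ 1` in `x_i`.  So the `x_top`-linear certificate only ever sees seeds with `μ₁ ≤ deg`.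
* `aeval_formCoeff_eq_zero_of_apply_eq` — if every monomial of `q` has degree `r` in `x_i` and
  `-χ(i) ≠ r·δ`, then `F(q) = 0`.  So a top-pure certificate of `x_top`-degree `r` only sees seeds
  with `μ₁ = r·deg` — one `r` per seed; since `μ₁` and `deg` add under products, products of seeds
  visible at DIFFERENT `r` (e.g. the transvectant sources `S_{2k}` of binary forms, visible at
  `r = n - k` only) are invisible everywhere: "richness from binary semi-invariants" cannot be
  certified twist-free.

Mechanism: a torus weight vector is a combination of monomials `∏_d X_d^{s(d)}` of torus weight `χ`
(`monWeight_eq_of_mem_weightSpace`), i.e. `∑_d s(d)·d(i) = -χ(i)`, while `∑_d s(d) = δ`; a monomial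
surviving at `q` only uses coordinates `d` with `q_d ≠ 0`, whence `d(i) ≤ 1` (resp. `= r`).
No definitions; sorry-free; any index type, over `ℂ`. [this seat; Fulton–Harris §15.5 (weights of `Sym(Sym V)`)]
-/

set_option linter.dupNamespace false

namespace Summit.ValiantsHypothesis.ValiantsHypothesis.Theorems.ValuativeFlip

open MvPolynomial
open scoped BigOperators
open Literature.NumberTheory.DiophantineGeometry Literature.Computability.AlgebraicComplexity

noncomputable section

variable {σ : Type*} [Fintype σ] [LinearOrder σ]

/-- The value of a polynomial function at a coefficient vector, monomial by monomial:
`F(q) = ∑_s coeff_s F · ∏_d q_d^{s(d)}`. [folklore] -/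
theorem aeval_formCoeff_eq_sum {n : ℕ} (q : MvPolynomial σ ℂ) (F : MvPolynomial (DegIdx σ n) ℂ) :
    aeval (formCoeff n q) F =
      ∑ s ∈ F.support, coeff s F * s.prod fun d e => (coeff d.1 q) ^ e := by
  conv_lhs => rw [F.as_sum, map_sum]
  refine Finset.sum_congr rfl fun s _ => ?_
  rw [aeval_monomial, Algebra.algebraMap_self_apply]
  rfl

/-- For a monomial `s` of a torus weight vector of weight `χ` that is a form of degree `δ`:
`∑_d s(d)·d(i) = -χ(i)` and `∑_d s(d) = δ`. [folklore] -/
theorem sum_mul_apply_eq_of_mem_support {n δ : ℕ} {χ : Weight σ} {F : MvPolynomial (DegIdx σ n) ℂ}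
    (hF : F ∈ weightSpace (coordRep σ ℂ n) χ) (hFδ : F.IsHomogeneous δ) {s : DegIdx σ n →₀ ℕ}
    (hs : s ∈ F.support) (i : σ) :
    ((∑ d ∈ s.support, s d * d.1 i : ℕ) : ℤ) = -χ i ∧ (∑ d ∈ s.support, s d) = δ := by
  classical
  constructor
  · have hw := congrFun (monWeight_eq_of_mem_weightSpace hF hs) i
    rw [monWeight_apply] at hw
    omega
  · have h := hFδ (mem_support_iff.mp hs)
    rw [Finsupp.weight_apply, Finsupp.sum] at h
    simpa using h

/-- **Visibility law, `x_i`-linear points.**  A torus weight vector `F ∈ ℂ[Sym^n ℂ^σ]` of weight `χ`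
and degree `δ` with `-χ(i) > δ` vanishes at every form `q` of degree `≤ 1` in `x_i`: each monomial
`∏_d X_d^{s(d)}` of `F` has `∑ s(d) d(i) = -χ(i) > δ = ∑ s(d)`, so some `d` with `s(d) > 0` has
`d(i) ≥ 2`, and `q_d = 0`.  (For `χ = μ*` on `MatIdx n`, `-χ(top) = μ₁`: the `x_top`-linear seed
certificate of `psl_seedLift_transfer` only sees seeds with `μ₁ ≤ deg`.) [this file] -/
theorem aeval_formCoeff_eq_zero_of_apply_le_one {n δ : ℕ} {χ : Weight σ}
    {F : MvPolynomial (DegIdx σ n) ℂ} (hF : F ∈ weightSpace (coordRep σ ℂ n) χ)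
    (hFδ : F.IsHomogeneous δ) (i : σ) (hχ : (δ : ℤ) < -χ i)
    {q : MvPolynomial σ ℂ} (hq : ∀ e ∈ q.support, e i ≤ 1) :
    aeval (formCoeff n q) F = 0 := by
  classical
  rw [aeval_formCoeff_eq_sum]
  refine Finset.sum_eq_zero fun s hs => ?_
  obtain ⟨hwt, hdeg⟩ := sum_mul_apply_eq_of_mem_support hF hFδ hs i
  -- some coordinate used by the monomial has `d(i) ≥ 2`, hence vanishes at `q`
  have hex : ∃ d ∈ s.support, 2 ≤ d.1 i := by
    by_contra hno
    push Not at hno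
    have hle : (∑ d ∈ s.support, s d * d.1 i) ≤ ∑ d ∈ s.support, s d :=
      Finset.sum_le_sum fun d hd => by
        have := hno d hd
        calc s d * d.1 i ≤ s d * 1 := Nat.mul_le_mul_left _ (by omega)
          _ = s d := mul_one _
    omega
  obtain ⟨d, hd, hd2⟩ := hex
  have hqd : coeff d.1 q = 0 := by
    by_contra hne
    have := hq d.1 (mem_support_iff.mpr hne)
    omega
  rw [Finsupp.prod, Finset.prod_eq_zero hd (by rw [hqd, zero_pow (Finsupp.mem_support_iff.mp hd)]),
    mul_zero]

/-- **Visibility law, `x_i`-pure points.**  A torus weight vector `F ∈ ℂ[Sym^n ℂ^σ]` of weight `χ`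
and degree `δ` vanishes at every form `q` all of whose monomials have degree `r` in `x_i`, unless
`-χ(i) = r·δ`: a monomial of `F` surviving at `q` only uses coordinates `d` with `d(i) = r`, so
`-χ(i) = ∑ s(d) d(i) = r ∑ s(d) = rδ`.  (For `χ = μ*`: the top-pure certificate
`mk_liftHWV_ne_zero_of_topPure` of `x_top`-degree `r` only sees seeds with `μ₁ = r·deg`; both sides
add under products, so products of seeds visible at different `r` are visible nowhere.) [this file] -/
theorem aeval_formCoeff_eq_zero_of_apply_eq {n δ : ℕ} {χ : Weight σ}
    {F : MvPolynomial (DegIdx σ n) ℂ} (hF : F ∈ weightSpace (coordRep σ ℂ n) χ)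
    (hFδ : F.IsHomogeneous δ) (i : σ) {r : ℕ} (hχ : -χ i ≠ ((r * δ : ℕ) : ℤ))
    {q : MvPolynomial σ ℂ} (hq : ∀ e ∈ q.support, e i = r) :
    aeval (formCoeff n q) F = 0 := by
  classical
  rw [aeval_formCoeff_eq_sum]
  refine Finset.sum_eq_zero fun s hs => ?_
  obtain ⟨hwt, hdeg⟩ := sum_mul_apply_eq_of_mem_support hF hFδ hs i
  -- some coordinate used by the monomial has `d(i) ≠ r`, hence vanishes at `q`
  have hex : ∃ d ∈ s.support, d.1 i ≠ r := by
    by_contra hno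
    push Not at hno
    have heq : (∑ d ∈ s.support, s d * d.1 i) = r * ∑ d ∈ s.support, s d := by
      rw [Finset.mul_sum]
      exact Finset.sum_congr rfl fun d hd => by rw [hno d hd, mul_comm]
    apply hχ
    rw [← hwt, heq, hdeg]
  obtain ⟨d, hd, hdr⟩ := hex
  have hqd : coeff d.1 q = 0 := by
    by_contra hne
    exact hdr (hq d.1 (mem_support_iff.mpr hne))
  rw [Finsupp.prod, Finset.prod_eq_zero hd (by rw [hqd, zero_pow (Finsupp.mem_support_iff.mp hd)]),
    mul_zero]

/-- The same two laws for HIGHEST-weight vectors (`B`-semi-invariants are torus weight vectors,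
`highestWeightSpace_le_weightSpace`), in the form used by the seed files: a highest-weight vector of
weight `χ` and degree `δ` with `-χ(i) > δ` has no nonzero value on `x_i`-linear forms. [this file] -/
theorem aeval_formCoeff_eq_zero_of_mem_highestWeightSpace_of_apply_le_one {n δ : ℕ} {χ : Weight σ}
    {F : MvPolynomial (DegIdx σ n) ℂ} (hF : F ∈ highestWeightSpace (coordRep σ ℂ n) χ)
    (hFδ : F.IsHomogeneous δ) (i : σ) (hχ : (δ : ℤ) < -χ i)
    {q : MvPolynomial σ ℂ} (hq : ∀ e ∈ q.support, e i ≤ 1) :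
    aeval (formCoeff n q) F = 0 :=
  aeval_formCoeff_eq_zero_of_apply_le_one (highestWeightSpace_le_weightSpace _ _ hF) hFδ i hχ hq

/-- … and no nonzero value on `x_i`-pure forms of `x_i`-degree `r` unless `-χ(i) = rδ`. [this file] -/
theorem aeval_formCoeff_eq_zero_of_mem_highestWeightSpace_of_apply_eq {n δ : ℕ} {χ : Weight σ}
    {F : MvPolynomial (DegIdx σ n) ℂ} (hF : F ∈ highestWeightSpace (coordRep σ ℂ n) χ)
    (hFδ : F.IsHomogeneous δ) (i : σ) {r : ℕ} (hχ : -χ i ≠ ((r * δ : ℕ) : ℤ))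
    {q : MvPolynomial σ ℂ} (hq : ∀ e ∈ q.support, e i = r) :
    aeval (formCoeff n q) F = 0 :=
  aeval_formCoeff_eq_zero_of_apply_eq (highestWeightSpace_le_weightSpace _ _ hF) hFδ i hχ hq

end

end Summit.ValiantsHypothesis.ValiantsHypothesis.Theorems.ValuativeFlip
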